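import Mathlib.RingTheory.Ideal.Maps
import Mathlib.Algebra.Algebra.Basic
import HarnessLib

/-!
# Direct summands inherit the weakly-F-regular clause (Hochster–Huneke 1990, Prop. 4.12)

Route `FrobeniusLadder`, line `Sketch` of crux `FRationalResolution` inserts the rung
"weakly F-regular": every ideal `I` of the (domain) stalk is tightly closed, in the inline form
`c ≠ 0 ∧ (∀ e, c * y ^ (p ^ e) ∈ span {z ^ (p ^ e) | z ∈ I}) → y ∈ I`.
This file records the structural fact that this class of rings is closed under **direct
summands**: if `R → S` is an injective algebra map admitting an `R`-linear retraction
`ρ : S → R` (`ρ ∘ algebraMap R S = id`) and every ideal of `S` satisfies the clause, then every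
ideal of `R` does. No characteristic, primality or domain hypothesis is needed.

Proof: push the data forward along `φ = algebraMap R S` into the extended ideal `I.map φ`
(Frobenius-power brackets are mapped into Frobenius-power brackets), apply the clause in `S`
to get `φ y ∈ I.map φ`, and pull back with the retraction: `ρ` maps `I.map φ = I • S` into `I`
because it is `R`-linear, and `ρ (φ y) = y`.

Consequence used by the lead: rings of invariants of linearly reductive groups, Veronese
subrings and normal toric rings (direct summands of polynomial rings) lie in the residual class
of the crux, so its hypothesis is not summit-trivial.
-/

-- single-problem summit: the doubled namespace component is forced
set_option linter.dupNamespace false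

noncomputable section

namespace Summit.ResolutionOfSingularities.ResolutionOfSingularities.Theorems.FRationalResolution

/-- The algebra map sends the `q`-th Frobenius-power bracket `span {z ^ q | z ∈ I}` of an ideal
`I ⊆ R` into the `q`-th Frobenius-power bracket of the extended ideal `I.map (algebraMap R S)`. -/
theorem weaklyFRegularClause_of_retract_map_mem {R S : Type} [CommRing R] [CommRing S]
    [Algebra R S] (I : Ideal R) (q : ℕ) {x : R}
    (hx : x ∈ Ideal.span ((fun z : R => z ^ q) '' (I : Set R))) :
    algebraMap R S x ∈
      Ideal.span ((fun z : S => z ^ q) '' (I.map (algebraMap R S) : Set S)) := by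
  have h1 : algebraMap R S x ∈
      (Ideal.span ((fun z : R => z ^ q) '' (I : Set R))).map (algebraMap R S) :=
    Ideal.mem_map_of_mem _ hx
  rw [Ideal.map_span] at h1
  refine Ideal.span_mono ?_ h1
  rintro _ ⟨_, ⟨z, hz, rfl⟩, rfl⟩
  exact ⟨algebraMap R S z, Ideal.mem_map_of_mem _ hz, by simp only [map_pow]⟩

/-- An `R`-linear map `ρ : S → R` sends the extended ideal `I.map (algebraMap R S) = I • S`
back into `I`: for `x ∈ I.map (algebraMap R S)` and any `s : S`, `ρ (s * x) ∈ I`. (The extra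
multiplier `s` makes the statement stable under the `S`-module structure of the span.) -/
theorem weaklyFRegularClause_of_retract_rho_mem {R S : Type} [CommRing R] [CommRing S]
    [Algebra R S] (ρ : S →ₗ[R] R) (I : Ideal R) {x : S}
    (hx : x ∈ I.map (algebraMap R S)) (s : S) : ρ (s * x) ∈ I := by
  change x ∈ Ideal.span ((algebraMap R S) '' (I : Set R)) at hx
  induction hx using Submodule.span_induction generalizing s with
  | mem x h =>
    obtain ⟨i, hi, rfl⟩ := h
    have hsi : s * algebraMap R S i = i • s := by rw [Algebra.smul_def, mul_comm]
    rw [hsi, map_smul, smul_eq_mul]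
    exact I.mul_mem_right _ hi
  | zero => simp only [mul_zero, map_zero, Submodule.zero_mem]
  | add x y _ _ hx hy =>
    rw [mul_add, map_add]
    exact I.add_mem (hx s) (hy s)
  | smul a x _ hx =>
    rw [smul_eq_mul, ← mul_assoc]
    exact hx (s * a)

/-- **Direct summands of rings all of whose ideals are tightly closed again have all ideals
tightly closed** (Hochster–Huneke 1990, Prop. 4.12, inline clause form). If `algebraMap R S` is
injective and split by an `R`-linear retraction `ρ` (`ρ (algebraMap R S r) = r`), and every
ideal `I` of `S` satisfies `c ≠ 0 → (∀ e, c * y ^ p ^ e ∈ span {z ^ p ^ e | z ∈ I}) → y ∈ I`,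
then so does every ideal of `R`. -/
theorem weaklyFRegularClause_of_retract (p : ℕ) {R S : Type} [CommRing R] [CommRing S]
    [Algebra R S] (hinj : Function.Injective (algebraMap R S)) (ρ : S →ₗ[R] R)
    (hρ : ∀ r : R, ρ (algebraMap R S r) = r)
    (hS : ∀ I : Ideal S, ∀ y c : S, c ≠ 0 →
      (∀ e : ℕ, c * y ^ p ^ e ∈ Ideal.span ((fun z : S => z ^ p ^ e) '' (I : Set S))) → y ∈ I) :
    ∀ I : Ideal R, ∀ y c : R, c ≠ 0 →
      (∀ e : ℕ, c * y ^ p ^ e ∈ Ideal.span ((fun z : R => z ^ p ^ e) '' (I : Set R))) →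
      y ∈ I := by
  intro I y c hc h
  have hc' : algebraMap R S c ≠ 0 := (map_ne_zero_iff _ hinj).mpr hc
  have hy' : algebraMap R S y ∈ I.map (algebraMap R S) := by
    refine hS (I.map (algebraMap R S)) (algebraMap R S y) (algebraMap R S c) hc' fun e => ?_
    have he := weaklyFRegularClause_of_retract_map_mem (S := S) I (p ^ e) (h e)
    simpa only [map_mul, map_pow] using he
  have hy := weaklyFRegularClause_of_retract_rho_mem ρ I hy' 1
  rwa [one_mul, hρ] at hy

end Summit.ResolutionOfSingularities.ResolutionOfSingularities.Theorems.FRationalResolution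

end
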